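import Summits.CriticalPhenomena.PercolationContinuityZ3.Theorems.Transplant.PlanarSkeletonSignDefs
import Summits.CriticalPhenomena.PercolationContinuityZ3.Theorems.Transplant.PlanarSkeletonNegSlabs
import HarnessLib

/-!
# The D″ nodes in MINIMAL form: the binders `G.Connected`, `Countable`, quasi-transitivity and a.s. uniqueness are all idle

builds on p205010 (kernel theorem, internal audit signed; external expert review pending) — nothing in this file uses p205010.
Lane `prim-bschramm`, seat `prim-bschramm-p5` (gen 5; METHOD = sharpness: which hypotheses the transplant must use), helper file
(`--supports stmt-CriticalPhenomena-4575 --as helper`).  Memo: `HOME/bschramm/P5-SHARPNESS.md` §22.10.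

`samePDropOfSkeletonNeg_iff_minimal`, `samePDropOfSkeletonSign_iff_minimal`: each conjecture node is EQUIVALENT to
"for every locally finite `G` carrying the skeleton structure, every base vertex `t` with `p_c(G,t) < 1` and subcritical cylinders at `p_c`:
`θ_t(p_c) = 0`" — no connectedness (`PlanarSkeletonNeg.graph_connected`, p245511), no countability (from connectedness and local finiteness),
no quasi-transitivity (`PlanarSkeletonNeg.isQuasiTransitive`, frames), no uniqueness (growth split: Hutchcroft 2016 on the exponential branch,
Burton–Keane on the amenable branch — `continuity_of_skeletonNeg_drop_qt`).  So the load-bearing inputs of D″ are exactly: the skeleton fields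
(φ Lipschitz, finitely many types, frames, `neg`/`flip`, (μ), (ι), (κ)), `p_c < 1`, and Φ2 at `p_c`; the refuter's table `P5-SHARPNESS.md` §2 records
which of THESE cannot be dropped (rows 1–32).
[cite: BenjaminiSchramm1996, Conj. 4] [cite: Hutchcroft2016, Thm. 1] [cite: LyonsPeres2016, §6.1, Thm. 7.6] [cite: KozmaNitzan2024, §1 p. 2 (approach 1)]
-/

noncomputable section

namespace Summit.CriticalPhenomena.PercolationContinuityZ3.Theorems.Transplant

open MeasureTheory Literature.Probability.Percolation Literature.Probability.LatticeModels SimpleGraph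
open Literature.Barriers.CriticalPhenomena (IsQuasiTransitive countable_of_connected_of_locallyFinite)
open Literature.Barriers.CriticalPhenomena (HasExponentialGrowth Hutchcroft2016_noPercolationAtCriticality_holds)
open scoped Classical

/-- **The D″ node (central inversion) in minimal form**: `SamePDropOfSkeletonNeg` ↔ `θ_t(p_c) = 0` for every locally finite `G` with a
`PlanarSkeletonNeg`, every base vertex `t` with `p_c(G,t) < 1` and Φ2 at `p_c` — connectedness, countability, quasi-transitivity and uniqueness
are consequences of the structure (resp. of the growth dichotomy), not hypotheses. [cite: BenjaminiSchramm1996, Conj. 4] [cite: Hutchcroft2016, Thm. 1] -/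
theorem samePDropOfSkeletonNeg_iff_minimal : SamePDropOfSkeletonNeg ↔
    ∀ {V : Type} (G : SimpleGraph V) [G.LocallyFinite] (Φ : PlanarSkeletonNeg G), ∀ t ∈ Φ.types,
      criticalProb G t < 1 → Φ.CylSubcritical (criticalProbIOf G t) → theta G t (criticalProbIOf G t) = 0 := by
  constructor
  · intro hD V G _ Φ t ht hpc hC
    exact continuity_of_skeletonNeg_drop_qt hD G Φ (Φ.graph_connected t) Φ.isQuasiTransitive t ht hpc hC
  · intro hK
    refine samePDropOfSkeletonNeg_iff_critical.2 ?_
    intro V _ _ G _ Φ _ t ht hpc _ hC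
    exact hK G Φ t ht hpc hC

/-- **The D″ node (axis-type point group) in minimal form**: `SamePDropOfSkeletonSign` ↔ `θ_t(p_c) = 0` for every locally finite `G` with a
`PlanarSkeletonSign`, every base vertex `t` with `p_c(G,t) < 1` and Φ2 at `p_c`. [cite: BenjaminiSchramm1996, Conj. 4] [cite: Hutchcroft2016, Thm. 1] -/
theorem samePDropOfSkeletonSign_iff_minimal : SamePDropOfSkeletonSign ↔
    ∀ {V : Type} (G : SimpleGraph V) [G.LocallyFinite] (Φ : PlanarSkeletonSign G), ∀ t ∈ Φ.types,
      criticalProb G t < 1 → Φ.CylSubcritical (criticalProbIOf G t) → theta G t (criticalProbIOf G t) = 0 := by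
  constructor
  · intro hD V G _ Φ t ht hpc hC
    exact continuity_of_skeletonSign_drop_qt hD G Φ (Φ.toPlanarSkeletonNeg.graph_connected t) Φ.toPlanarSkeletonNeg.isQuasiTransitive
      t ht hpc hC
  · intro hK
    refine samePDropOfSkeletonSign_iff_critical.2 ?_
    intro V _ _ G _ Φ _ t ht hpc _ hC
    exact hK G Φ t ht hpc hC

/-! ## §2 The conjecture nodes reduce to their SUBEXPONENTIAL branch (the entry point of the D″ closure) -/

/-- **The D″ node (central inversion) follows from its subexponential-growth case at criticality**: graphs of exponential growth are
Hutchcroft's theorem (quasi-transitivity and connectedness come from the skeleton), so a proof of `SamePDropOfSkeletonNeg` need only treat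
`G` NOT of exponential growth, at `p = p_c(G,t) < 1`, under Φ2 — exactly where `PlanarSkeletonNeg.slab_F1_inputs` (p245511) feeds LEVEL 0.
Twin of the product node's `bsConj4_boxProdZ2_of_subexponential_case`. [cite: Hutchcroft2016, Thm. 1] [cite: BenjaminiSchramm1996, Conj. 4] -/
theorem samePDropOfSkeletonNeg_of_subexponential_case
    (h : ∀ {V : Type} (G : SimpleGraph V) [G.LocallyFinite] (Φ : PlanarSkeletonNeg G), ¬ HasExponentialGrowth G →
      ∀ t ∈ Φ.types, criticalProb G t < 1 → Φ.CylSubcritical (criticalProbIOf G t) → theta G t (criticalProbIOf G t) = 0) :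
    SamePDropOfSkeletonNeg := by
  refine samePDropOfSkeletonNeg_iff_minimal.2 fun G _ Φ t ht hpc hC => ?_
  by_cases hg : HasExponentialGrowth G
  · exact Hutchcroft2016_noPercolationAtCriticality_holds G (Φ.graph_connected t) Φ.isQuasiTransitive hg t
  · exact h G Φ hg t ht hpc hC

/-- **The D″ node (axis-type point group) follows from its subexponential-growth case at criticality** — THE TARGET SHAPE for the D″ v2
closure (LEVELS 1–2 + params): `∀ G Φ, ¬ HasExponentialGrowth G → ∀ t ∈ types, p_c(G,t) < 1 → CylSubcritical (p_c) → θ_t(p_c) = 0`.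
[cite: Hutchcroft2016, Thm. 1] [cite: BenjaminiSchramm1996, Conj. 4] [cite: KozmaNitzan2024, §1 p. 2 (approach 1)] -/
theorem samePDropOfSkeletonSign_of_subexponential_case
    (h : ∀ {V : Type} (G : SimpleGraph V) [G.LocallyFinite] (Φ : PlanarSkeletonSign G), ¬ HasExponentialGrowth G →
      ∀ t ∈ Φ.types, criticalProb G t < 1 → Φ.CylSubcritical (criticalProbIOf G t) → theta G t (criticalProbIOf G t) = 0) :
    SamePDropOfSkeletonSign := by
  refine samePDropOfSkeletonSign_iff_minimal.2 fun G _ Φ t ht hpc hC => ?_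
  by_cases hg : HasExponentialGrowth G
  · exact Hutchcroft2016_noPercolationAtCriticality_holds G (Φ.toPlanarSkeletonNeg.graph_connected t)
      Φ.toPlanarSkeletonNeg.isQuasiTransitive hg t
  · exact h G Φ hg t ht hpc hC

end Summit.CriticalPhenomena.PercolationContinuityZ3.Theorems.Transplant

end
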